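import Literature.NumberTheory.Sieve.LinearSieveConstant
import HarnessLib

/-!
# The linear sieve functions on the second range: `F₁` on `[3, 5]`, `f₁` on `[4, 6]`, and `f₁(5)`

Topic `Literature/NumberTheory/Sieve`. `LinearSieveConstant` proves the closed forms of the
Jurkat–Richert functions of the linear sieve on their first ranges, `F₁(s) = 2e^γ/s` (`0 < s ≤ 3`,
`upperSieveFun_one_eq_holds`) and `f₁(s) = 2e^γ log(s − 1)/s` (`2 ≤ s ≤ 4`,
`lowerSieveFun_one_eq_holds`), from the delay-differential system
`(s F₁(s))' = f₁(s − 1)` (`s > 3`), `(s f₁(s))' = F₁(s − 1)` (`s > 2`)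
(`isBetaSieveSolution_upperSieveFun_one`, `LinearSieveExistence`). Integrating the system once
more gives the functions on the next ranges, which is what Chen's proof of
`P_x(1,2) ≥ 0.67 x C_x/(log x)²` uses (sieving level `z = x^{1/10}`, so `s = 5`; Chen Jing-run,
Sci. Sinica 16 (1973), proof of Lemma 9, p. 175 of the original = PDF p. 167 of the reprint in
Wang Yuan (ed.), *Goldbach Conjecture* (1984), formula (30) and the displays following it):

* `upperSieveFun_one_eq_of_mem_Icc` — for `3 ≤ s ≤ 5`,
  `s F₁(s) = 2e^γ (1 + ∫_2^{s−1} log(t − 1)/t dt)` (Chen: "`uF(u) = 2e^γ(1 + ∫_2^{u−1} log(t−1)/t dt)`");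
* `lowerSieveFun_one_eq_of_mem_Icc` — for `4 ≤ s ≤ 6`,
  `s f₁(s) = 2e^γ (log(s − 1) + ∫_4^s J(t − 2)/(t − 1) dt)`, `J(w) = ∫_2^w log(t − 1)/t dt`
  (i.e. `s f₁(s) = 4 f₁(4) + ∫_4^s F₁(t − 1) dt` with the previous item inserted);
* `five_mul_lowerSieveFun_one` — Chen's display
  `5 f₁(5) = 2e^γ (log 4 + ∫_3^4 (du/u) ∫_2^{u−1} log(t − 1)/t dt)`.

Everything here is PROVED (two applications of the fundamental theorem of calculus to the system
of `IsBetaSieveSolution`); no named facts. The inner integral is given a name, `linearSieveJ`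
(`J(w) = ∫_2^w log(t − 1)/t dt`), with its derivative, continuity on `(1, ∞)` and sign.

## References

* Chen Jing-run, *On the representation of a larger even integer as the sum of a prime and the
  product of at most two primes*, Sci. Sinica 16 (1973) 157–176, Lemma 9 and (30) (reprint: Wang
  Yuan (ed.), *Goldbach Conjecture*, World Scientific 1984, PDF p. 167). [ChenSciSinica1973]
* W. B. Jurkat, H.-E. Richert, *An improvement of Selberg's sieve method I*, Acta Arith. 11 (1965)
  217–240, Thm 4–5 (the functions `F`, `f` and their recursion). [JurkatRichertActaArith1965]
* H. Halberstam, H.-E. Richert, *Sieve Methods* (1974), Ch. 8 (8.2.8)–(8.2.10). [HalberstamRichert1974]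
-/

open Filter Set MeasureTheory intervalIntegral

noncomputable section

namespace Literature.NumberTheory.Sieve

/-! ### The inner integral `J(w) = ∫_2^w log(t − 1)/t dt` -/

/-- Chen's inner integral `J(w) = ∫_2^w log(t − 1)/t dt` (Chen 1973, the displays after (30):
`uF(u) = 2e^γ(1 + ∫_2^{u−1} log(t−1)/t dt)`); `J(w) ≥ 0` for `w ≥ 2`.
[cite: ChenSciSinica1973, Lemma 9 eq. (30) (reprint p. 167)] -/
def linearSieveJ (w : ℝ) : ℝ :=
  ∫ t in (2 : ℝ)..w, Real.log (t - 1) / t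

/-- `J(2) = 0`. [folklore] -/
@[simp] theorem linearSieveJ_two : linearSieveJ 2 = 0 := by
  simp [linearSieveJ]

/-- The integrand `log(t − 1)/t` of `J` is continuous on `(1, ∞)`. [folklore] -/
theorem continuousOn_log_sub_one_div : ContinuousOn (fun t : ℝ => Real.log (t - 1) / t) (Ioi 1) := by
  refine ContinuousOn.div ((continuousOn_id.sub continuousOn_const).log fun t ht => ?_) continuousOn_id
    fun t ht => ?_
  · exact sub_ne_zero.mpr (mem_Ioi.mp ht).ne'
  · exact (zero_lt_one.trans (mem_Ioi.mp ht)).ne'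

/-- `J'(w) = log(w − 1)/w` for `w > 1`. [folklore] -/
theorem hasDerivAt_linearSieveJ {w : ℝ} (hw : 1 < w) :
    HasDerivAt linearSieveJ (Real.log (w - 1) / w) w := by
  have hsub : uIcc 2 w ⊆ Ioi 1 := fun t ht => by
    rw [mem_uIcc] at ht
    rw [mem_Ioi]
    rcases ht with ⟨h1, -⟩ | ⟨h1, -⟩ <;> linarith
  have hint : IntervalIntegrable (fun t : ℝ => Real.log (t - 1) / t) volume 2 w :=
    (continuousOn_log_sub_one_div.mono hsub).intervalIntegrable
  exact intervalIntegral.integral_hasDerivAt_right hint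
    (continuousOn_log_sub_one_div.stronglyMeasurableAtFilter isOpen_Ioi w hw)
    (continuousOn_log_sub_one_div.continuousAt (Ioi_mem_nhds hw))

/-- `J` is continuous on `(1, ∞)`. [folklore] -/
theorem continuousOn_linearSieveJ : ContinuousOn linearSieveJ (Ioi 1) := fun _ hw =>
  (hasDerivAt_linearSieveJ (mem_Ioi.mp hw)).continuousAt.continuousWithinAt

/-- `J(w) ≥ 0` for `w ≥ 2` (the integrand is nonnegative on `[2, w]`). [folklore] -/
theorem linearSieveJ_nonneg {w : ℝ} (hw : 2 ≤ w) : 0 ≤ linearSieveJ w := by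
  refine intervalIntegral.integral_nonneg hw fun t ht => ?_
  have h1 : 0 ≤ Real.log (t - 1) := Real.log_nonneg (by linarith [ht.1])
  have h2 : 0 < t := by linarith [ht.1]
  positivity

/-- `J` is monotone on `[2, ∞)`. [folklore] -/
theorem linearSieveJ_mono {v w : ℝ} (hv : 2 ≤ v) (hvw : v ≤ w) : linearSieveJ v ≤ linearSieveJ w := by
  have hsub : uIcc 2 w ⊆ Ioi 1 := fun t ht => by
    rw [mem_uIcc] at ht
    rw [mem_Ioi]
    rcases ht with ⟨h1, -⟩ | ⟨h1, -⟩ <;> linarith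
  have hint : IntervalIntegrable (fun t : ℝ => Real.log (t - 1) / t) volume 2 w :=
    (continuousOn_log_sub_one_div.mono hsub).intervalIntegrable
  have h1 : IntervalIntegrable (fun t : ℝ => Real.log (t - 1) / t) volume 2 v :=
    hint.mono_set (by rw [uIcc_of_le hv, uIcc_of_le (hv.trans hvw)]; exact Icc_subset_Icc le_rfl hvw)
  have h2 : IntervalIntegrable (fun t : ℝ => Real.log (t - 1) / t) volume v w :=
    hint.mono_set (by rw [uIcc_of_le hvw, uIcc_of_le (hv.trans hvw)]; exact Icc_subset_Icc hv le_rfl)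
  rw [linearSieveJ, linearSieveJ, ← intervalIntegral.integral_add_adjacent_intervals h1 h2]
  have h0 : 0 ≤ ∫ t in v..w, Real.log (t - 1) / t := by
    refine intervalIntegral.integral_nonneg hvw fun t ht => ?_
    have h1 : 0 ≤ Real.log (t - 1) := Real.log_nonneg (by linarith [ht.1])
    have h2 : 0 < t := by linarith [ht.1]
    positivity
  linarith

/-! ### `F₁` on `[3, 5]` -/

/-- **The linear-sieve upper function on `[3, 5]`**: for `3 ≤ s ≤ 5`,
`F₁(s) = 2e^γ (1 + ∫_2^{s−1} log(t − 1)/t dt) / s`, i.e. Chen's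
"`uF(u) = 2e^γ(1 + ∫_2^{u−1} log(t−1)/t dt)`" (integrate `(sF₁(s))' = f₁(s − 1) = 2e^γ log(s − 2)/(s − 1)`
from `s = 3`, where `3F₁(3) = 2e^γ`). [cite: ChenSciSinica1973, Lemma 9 eq. (30) (reprint p. 167)] -/
theorem upperSieveFun_one_eq_of_mem_Icc {s : ℝ} (hs : s ∈ Icc (3 : ℝ) 5) :
    upperSieveFun 1 s =
      2 * Real.exp Real.eulerMascheroniConstant * (1 + linearSieveJ (s - 1)) / s := by
  set A : ℝ := 2 * Real.exp Real.eulerMascheroniConstant with hA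
  have h := isBetaSieveSolution_upperSieveFun_one
  have hβ : siftingLimit 1 = 2 := siftingLimit_one_holds
  have hF3 : upperSieveFun 1 3 = A / 3 :=
    upperSieveFun_one_eq_holds (s := 3) ⟨by norm_num, le_rfl⟩
  have hs0 : 0 < s := by linarith [hs.1]
  rcases hs.1.eq_or_lt with h3 | h3
  · rw [← h3, hF3, show (3 : ℝ) - 1 = 2 by norm_num, linearSieveJ_two]
    ring
  -- `G t = t F₁(t)` has derivative `A log(t − 2)/(t − 1)` on `(3, s)`
  set G : ℝ → ℝ := fun t => t ^ (1 : ℝ) * upperSieveFun 1 t with hG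
  have hGd : ∀ t ∈ Ioo 3 s, HasDerivAt G (A * (Real.log (t - 2) / (t - 1))) t := by
    intro t ht
    have h1 := h.hasDerivAt_upper t (by rw [hβ]; linarith [ht.1])
    have hf : lowerSieveFun 1 (t - 1) = A * Real.log (t - 2) / (t - 1) := by
      rw [lowerSieveFun_one_eq_holds (s := t - 1) ⟨by linarith [ht.1], by linarith [ht.2, hs.2]⟩,
        show t - 1 - 1 = t - 2 by ring]
    refine h1.congr_deriv ?_
    rw [hf, sub_self, Real.rpow_zero]
    ring
  have hGc : ContinuousOn G (Icc 3 s) := by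
    refine ContinuousOn.mul (fun t ht => ?_) (h.continuousOn_upper.mono fun t ht => ?_)
    · exact (Real.continuousAt_rpow_const _ _ (Or.inl (by linarith [ht.1]))).continuousWithinAt
    · exact show (0 : ℝ) < t by linarith [ht.1]
  have hcont : ContinuousOn (fun t : ℝ => Real.log (t - 2) / (t - 1)) (Icc 3 s) := by
    refine ContinuousOn.div ((continuousOn_id.sub continuousOn_const).log fun t ht => ?_)
      (continuousOn_id.sub continuousOn_const) fun t ht => ?_
    · exact ne_of_gt (sub_pos.mpr (by show (2 : ℝ) < t; linarith [ht.1]))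
    · exact ne_of_gt (sub_pos.mpr (by show (1 : ℝ) < t; linarith [ht.1]))
  have hint : IntervalIntegrable (fun t : ℝ => A * (Real.log (t - 2) / (t - 1))) volume 3 s := by
    refine ContinuousOn.intervalIntegrable ?_
    rw [uIcc_of_le hs.1]
    exact continuousOn_const.mul hcont
  have hFTC := intervalIntegral.integral_eq_sub_of_hasDerivAt_of_le hs.1 hGc hGd hint
  have hI : ∫ t in (3 : ℝ)..s, A * (Real.log (t - 2) / (t - 1)) = A * linearSieveJ (s - 1) := by
    rw [intervalIntegral.integral_const_mul]
    congr 1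
    have h1 : (fun t : ℝ => Real.log (t - 2) / (t - 1)) =
        fun t => (fun u : ℝ => Real.log (u - 1) / u) (t - 1) := by
      ext t
      simp only [sub_sub]
      norm_num
    rw [h1, intervalIntegral.integral_comp_sub_right (fun u : ℝ => Real.log (u - 1) / u) 1,
      linearSieveJ]
    norm_num
  have hG3 : G 3 = A := by
    simp only [hG, Real.rpow_one, hF3]
    ring
  have hGs : G s = s * upperSieveFun 1 s := by simp only [hG, Real.rpow_one]
  rw [hI, hG3, hGs] at hFTC
  rw [eq_div_iff hs0.ne']
  linear_combination (-1 : ℝ) * hFTC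

/-- `t ↦ J(t − 2)/(t − 1)` is continuous on `[4, ∞) ∩ …` — stated on any `Icc 4 s`. [folklore] -/
theorem continuousOn_linearSieveJ_sub_two_div (s : ℝ) :
    ContinuousOn (fun t : ℝ => linearSieveJ (t - 2) / (t - 1)) (Icc 4 s) := by
  refine ContinuousOn.div ?_ (continuousOn_id.sub continuousOn_const) fun t ht => ?_
  · exact continuousOn_linearSieveJ.comp (continuousOn_id.sub continuousOn_const) fun t ht => by
      show t - 2 ∈ Ioi 1
      rw [mem_Ioi]
      linarith [ht.1]
  · exact ne_of_gt (sub_pos.mpr (by linarith [ht.1]))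

/-! ### `f₁` on `[4, 6]` and the value `f₁(5)` -/

/-- **The linear-sieve lower function on `[4, 6]`**: for `4 ≤ s ≤ 6`,
`f₁(s) = 2e^γ (log(s − 1) + ∫_4^s J(t − 2)/(t − 1) dt) / s` with `J(w) = ∫_2^w log(u − 1)/u du`
(integrate `(s f₁(s))' = F₁(s − 1)` from `s = 4`, where `4 f₁(4) = 2e^γ log 3`, inserting
`F₁(t − 1) = 2e^γ(1 + J(t − 2))/(t − 1)` from `upperSieveFun_one_eq_of_mem_Icc`; Chen:
"`5f(5) = 2e^γ log 3 + ∫_4^5 F(u − 1) du`"). [cite: ChenSciSinica1973, Lemma 9 eq. (30) (reprint p. 167)] -/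
theorem lowerSieveFun_one_eq_of_mem_Icc {s : ℝ} (hs : s ∈ Icc (4 : ℝ) 6) :
    lowerSieveFun 1 s =
      2 * Real.exp Real.eulerMascheroniConstant *
        (Real.log (s - 1) + ∫ t in (4 : ℝ)..s, linearSieveJ (t - 2) / (t - 1)) / s := by
  set A : ℝ := 2 * Real.exp Real.eulerMascheroniConstant with hA
  have h := isBetaSieveSolution_upperSieveFun_one
  have hβ : siftingLimit 1 = 2 := siftingLimit_one_holds
  have hA0 : 0 < A := by positivity
  have hf4 : lowerSieveFun 1 4 = A * Real.log 3 / 4 := by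
    rw [lowerSieveFun_one_eq_holds (s := 4) ⟨by norm_num, le_rfl⟩, show (4 : ℝ) - 1 = 3 by norm_num]
  have hs0 : 0 < s := by linarith [hs.1]
  rcases hs.1.eq_or_lt with h4 | h4
  · rw [← h4, hf4, intervalIntegral.integral_same, show (4 : ℝ) - 1 = 3 by norm_num]
    ring
  -- `G t = t f₁(t)` has derivative `F₁(t − 1) = A (1 + J(t − 2))/(t − 1)` on `(4, s)`
  set G : ℝ → ℝ := fun t => t ^ (1 : ℝ) * lowerSieveFun 1 t with hG
  have hGd : ∀ t ∈ Ioo 4 s, HasDerivAt G (A * ((1 + linearSieveJ (t - 2)) / (t - 1))) t := by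
    intro t ht
    have h1 := h.hasDerivAt_lower t (by rw [hβ]; linarith [ht.1])
    have hF : upperSieveFun 1 (t - 1) = A * (1 + linearSieveJ (t - 2)) / (t - 1) := by
      rw [upperSieveFun_one_eq_of_mem_Icc ⟨by linarith [ht.1], by linarith [ht.2, hs.2]⟩,
        show t - 1 - 1 = t - 2 by ring]
    refine h1.congr_deriv ?_
    rw [hF, sub_self, Real.rpow_zero]
    ring
  have hGc : ContinuousOn G (Icc 4 s) := by
    refine ContinuousOn.mul (fun t ht => ?_) (h.continuousOn_lower.mono fun t ht => ?_)
    · exact (Real.continuousAt_rpow_const _ _ (Or.inl (by linarith [ht.1]))).continuousWithinAt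
    · exact show (0 : ℝ) < t by linarith [ht.1]
  have hinv : ContinuousOn (fun t : ℝ => (t - 1)⁻¹) (Icc 4 s) :=
    (continuousOn_id.sub continuousOn_const).inv₀ fun t ht =>
      ne_of_gt (sub_pos.mpr (by show (1 : ℝ) < t; linarith [ht.1]))
  have hJc := continuousOn_linearSieveJ_sub_two_div s
  have hsplit : (fun t : ℝ => A * ((1 + linearSieveJ (t - 2)) / (t - 1))) =
      fun t => A * ((t - 1)⁻¹ + linearSieveJ (t - 2) / (t - 1)) := by
    ext t
    ring
  have hint : IntervalIntegrable (fun t : ℝ => A * ((1 + linearSieveJ (t - 2)) / (t - 1)))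
      volume 4 s := by
    rw [hsplit]
    refine ContinuousOn.intervalIntegrable ?_
    rw [uIcc_of_le hs.1]
    exact continuousOn_const.mul (hinv.add hJc)
  have hFTC := intervalIntegral.integral_eq_sub_of_hasDerivAt_of_le hs.1 hGc hGd hint
  have hint1 : IntervalIntegrable (fun t : ℝ => (t - 1)⁻¹) volume 4 s := by
    refine ContinuousOn.intervalIntegrable ?_
    rw [uIcc_of_le hs.1]
    exact hinv
  have hint2 : IntervalIntegrable (fun t : ℝ => linearSieveJ (t - 2) / (t - 1)) volume 4 s := by
    refine ContinuousOn.intervalIntegrable ?_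
    rw [uIcc_of_le hs.1]
    exact hJc
  have hI : ∫ t in (4 : ℝ)..s, A * ((1 + linearSieveJ (t - 2)) / (t - 1)) =
      A * (Real.log (s - 1) - Real.log 3 + ∫ t in (4 : ℝ)..s, linearSieveJ (t - 2) / (t - 1)) := by
    rw [hsplit, intervalIntegral.integral_const_mul, intervalIntegral.integral_add hint1 hint2,
      intervalIntegral.integral_comp_sub_right (fun u : ℝ => u⁻¹) 1,
      integral_inv_of_pos (by norm_num) (by linarith), Real.log_div (by linarith) (by norm_num)]
    norm_num
  have hG4 : G 4 = A * Real.log 3 := by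
    simp only [hG, Real.rpow_one, hf4]
    ring
  have hGs : G s = s * lowerSieveFun 1 s := by simp only [hG, Real.rpow_one]
  rw [hI, hG4, hGs] at hFTC
  rw [eq_div_iff hs0.ne']
  linear_combination (-1 : ℝ) * hFTC

/-- **Chen's value of `f₁(5)`**: `5 f₁(5) = 2e^γ (log 4 + ∫_3^4 (du/u) ∫_2^{u−1} log(t − 1)/t dt)`
(Chen 1973, the last display before (31); the linear-sieve lower function at `s = 5`, the value
used with `z = x^{1/10}`, `D = x^{1/2 − ε}`). [cite: ChenSciSinica1973, Lemma 9 eq. (30)–(31) (reprint p. 167)] -/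
theorem five_mul_lowerSieveFun_one :
    5 * lowerSieveFun 1 5 =
      2 * Real.exp Real.eulerMascheroniConstant *
        (Real.log 4 + ∫ u in (3 : ℝ)..4, linearSieveJ (u - 1) / u) := by
  rw [lowerSieveFun_one_eq_of_mem_Icc ⟨by norm_num, by norm_num⟩]
  have h1 : (fun t : ℝ => linearSieveJ (t - 2) / (t - 1)) =
      fun t => (fun u : ℝ => linearSieveJ (u - 1) / u) (t - 1) := by
    ext t
    simp only [sub_sub]
    norm_num
  have h2 : ∫ t in (4 : ℝ)..5, linearSieveJ (t - 2) / (t - 1) =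
      ∫ u in (3 : ℝ)..4, linearSieveJ (u - 1) / u := by
    rw [h1, intervalIntegral.integral_comp_sub_right (fun u : ℝ => linearSieveJ (u - 1) / u) 1]
    norm_num
  rw [h2, show (5 : ℝ) - 1 = 4 by norm_num]
  field_simp

/-- `F₁` is positive on `[3, 5]`: `F₁(s) ≥ 2e^γ/s > 0` there (`J ≥ 0`). [folklore] -/
theorem two_mul_exp_div_le_upperSieveFun_one {s : ℝ} (hs : s ∈ Icc (3 : ℝ) 5) :
    2 * Real.exp Real.eulerMascheroniConstant / s ≤ upperSieveFun 1 s := by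
  rw [upperSieveFun_one_eq_of_mem_Icc hs]
  have hs0 : 0 < s := by linarith [hs.1]
  have hJ : 0 ≤ linearSieveJ (s - 1) := linearSieveJ_nonneg (by linarith [hs.1])
  rw [div_le_div_iff_of_pos_right hs0]
  have hA : 0 < 2 * Real.exp Real.eulerMascheroniConstant := by positivity
  nlinarith

end Literature.NumberTheory.Sieve
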